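import Summits.ResolutionOfSingularities.ResolutionOfSingularities.Theorems.EquisingularLiftEquisingularLiftNatStrictTransformComap
import Summits.ResolutionOfSingularities.ResolutionOfSingularities.Theorems.EquisingularLiftEquisingularLiftNatCarrierDeltaSectionFrameDim
import Summits.ResolutionOfSingularities.ResolutionOfSingularities.Theorems.EquisingularLiftEquisingularLiftNatCarrierDeltaModelFrame
import Summits.ResolutionOfSingularities.ResolutionOfSingularities.Theorems.EquisingularLiftEquisingularLiftNatConePackDegreeOne
import Summits.ResolutionOfSingularities.ResolutionOfSingularities.Theorems.EquisingularLiftEquisingularLiftNatCodimTwoOrderOne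
import Literature.AlgebraicGeometry.Resolution.MarkedIdealsArithmetic
import HarnessLib

/-!
# [OURS · L1 W4.5(b) · EL♮(3)] HSUB(ReachTC⁺) — K7c EXACTNESS OF THE REGULAR IN-CARRIER STEP: the special fibre of the strict
# transforms of the carrier pair is the pair of downstairs strict transforms (registered stub `stub_elnat_tcPlusPointResolution`;
# driver p526242, brick K7c; consumes `TCPlus.Member` (iii)(v) of …NatSubchainSupplierInvDefs v3)

Crux `EquisingularLiftNat` = stmt-ResolutionOfSingularities-20038 (child EL♮(3) = stmt-ResolutionOfSingularities-20148), route
EquisingularLift, line `sections`. Helper file `--supports stmt-ResolutionOfSingularities-20148 --as helper` by res-L1-w45b-stub-1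
(HSUB(ReachTC⁺) assembly). HONEST FRAMING: OURS (cell res-hironaka, slot W4.5(b)); NOT a statement of any manuscript; AI-written,
weaker than expert review. No `sorry`; standard axioms.

SETTING. The model square over the DVR `O ↠ k`: `j : F₁ → X'` the special fibre of `r' : X' → Spec O`, a section `s` of `r'` through
`s(s₀) = j x` (`x` closed), the blow-up `τ : X₁ → X'` of `ker s`, the blow-up `υ : F₂ → F₁` of the reduced point `x`, and
`j₂ : F₂ → X₁` with `j₂ ≫ τ = υ ≫ j` and `(ker s) · 𝒪_{F₁} = 𝔪_x` (res-D-pv-029 `modelPointStep_of_section`). The in-carrier pair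
`(𝓢, K)` lies on the section (`𝓢 ⊔ K ≤ ker s`), has principal stalks at `j x`, and the quotient `𝒪_{X',j x} ⧸ (𝓢 ⊔ K)_{j x}` is
REGULAR OF CODIMENSION TWO (clause (v) of `TCPlus.Member` at the stepped point = «`D = V(𝓢) ∩ V(K)` is a regular surface at
`j x`»).

* **`comap_strictTransformIdeal_carrierPair_eq_sup`** — then
  `(St_τ 𝓢 ⊔ St_τ K) · 𝒪_{F₂} = St_υ (𝓢 · 𝒪_{F₁}) ⊔ St_υ (K · 𝒪_{F₁})`.

PROOF. A section frame `c` of `(ker s)_{j x}` (res-type-100 `exists_sectionFrame_forall_dim_at`: quasi-regular, `𝒪/(c) ≅ O`,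
`(c) + (ϖ) = 𝔪`, `ϖ ∉ (c)`); codimension two forces `h, f ∉ 𝔪²` for the local equations (…NatCodimTwoOrderOne p531429); so each
is a LINEAR form in `c` with a unit coefficient (…NatConePackDegreeOne p529089) — the order-one cone packs; F⁺5
(`comap_strictTransformIdeal_eq_of_model`, p519966) for `𝓢` and for `K`, and `comap_sup`.

References: [cite: GortzWedhorn2020, Prop. 13.91, Rem. 13.92]; [cite: Matsumura1987, Thm. 14.2].
-/

set_option linter.dupNamespace false -- mandated namespace `Summit.<Summit>.<Problem>` of this single-conjunct summit
set_option linter.overlappingInstances false -- signatures carry `[IsDomain O] [IsDiscreteValuationRing O]`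

noncomputable section

open CategoryTheory CategoryTheory.Limits AlgebraicGeometry TopologicalSpace Topology IsLocalRing
open Literature.AlgebraicGeometry.Resolution
open AlgebraicGeometry.Scheme.IdealSheafData

namespace Summit.ResolutionOfSingularities.ResolutionOfSingularities.Cruxes.EquisingularLiftNat.Sections

variable (O : Type) [CommRing O] [IsDomain O] [IsDiscreteValuationRing O] (k : Type) [Field k] (θ : O →+* k)

/-- **K7c, exactness of the regular in-carrier step.** In the model square (see the module docstring), for an in-carrier pair
`(𝓢, K)` on the section with principal stalks at `j x` and `𝒪_{X',j x} ⧸ (𝓢 ⊔ K)_{j x}` regular of codimension `2`: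
`(St_τ 𝓢 ⊔ St_τ K).comap j₂ = St_υ (𝓢.comap j) ⊔ St_υ (K.comap j)`. [cite: GortzWedhorn2020, Prop. 13.91] [OURS · L1 W4.5b]
brick K7c toward `stub_elnat_tcPlusPointResolution`; NOT a statement of the manuscript. -/
theorem comap_strictTransformIdeal_carrierPair_eq_sup (hθ : Function.Surjective θ) {X' X₁ F₁ F₂ : Scheme.{0}}
    (r' : X' ⟶ Spec (.of O)) [IsSeparated r'] [IsLocallyNoetherian X₁] [IsLocallyNoetherian F₂] [IsIntegral F₁] [IsIntegral F₂]
    [IsLocallyNoetherian F₁] (j : F₁ ⟶ X') (t : F₁ ⟶ Spec (.of k))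
    (hsq : IsPullback j t r' (Spec.map (CommRingCat.ofHom θ)))
    (s : Spec (.of O) ⟶ X') (hs : s ≫ r' = 𝟙 _) (τ : X₁ ⟶ X') (hτ : IsBlowup τ s.ker)
    (υ : F₂ ⟶ F₁) (j₂ : F₂ ⟶ X₁) (hcomm : j₂ ≫ τ = υ ≫ j) (x : F₁) (hx : IsClosed ({x} : Set F₁))
    (hυ : IsBlowup υ (vanishingIdeal ⟨{x}, hx⟩)) (hJ : s.ker.comap j = vanishingIdeal ⟨{x}, hx⟩)
    (hsx : s (closedPoint O) = j x) (hreg : IsRegularLocalRing (X'.presheaf.stalk (j x))) (ϖ : O) (hϖ : Irreducible ϖ)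
    -- the in-carrier pair
    (𝓢 K : X'.IdealSheafData) (hle : 𝓢 ⊔ K ≤ s.ker) (h𝓢p : (stalkIdeal 𝓢 (j x)).IsPrincipal)
    (hKp : (stalkIdeal K (j x)).IsPrincipal)
    (hDreg : IsRegularLocalRing (X'.presheaf.stalk (j x) ⧸ stalkIdeal (𝓢 ⊔ K) (j x)))
    (hDdim : ringKrullDim (X'.presheaf.stalk (j x) ⧸ stalkIdeal (𝓢 ⊔ K) (j x)) + 2 =
      ringKrullDim (X'.presheaf.stalk (j x))) :
    (strictTransformIdeal τ s.ker 𝓢 ⊔ strictTransformIdeal τ s.ker K).comap j₂ =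
      strictTransformIdeal υ (vanishingIdeal ⟨{x}, hx⟩) (𝓢.comap j) ⊔
        strictTransformIdeal υ (vanishingIdeal ⟨{x}, hx⟩) (K.comap j) := by
  classical
  haveI := hreg
  have hϖO : ϖ ∈ maximalIdeal O := by rw [hϖ.maximalIdeal_eq]; exact Ideal.mem_span_singleton_self ϖ
  -- (1) a section frame at `j x`
  obtain ⟨n, c, θR, hcI, hc, hdom, -, h𝔪, hϖc, -⟩ := exists_sectionFrame_forall_dim_at O r' s hs (j x) hsx hreg ϖ hϖ
  haveI := hdom
  have hc𝔪 : ∀ i, c i ∈ maximalIdeal (X'.presheaf.stalk (j x)) := fun i => by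
    rw [← h𝔪]; exact Ideal.mem_sup_left (Ideal.subset_span ⟨i, rfl⟩)
  have hI𝔪 : Ideal.span (Set.range c) ≤ maximalIdeal _ := Ideal.span_le.mpr (by rintro _ ⟨i, rfl⟩; exact hc𝔪 i)
  -- (2) local equations `h`, `f`
  obtain ⟨h, hh⟩ := h𝓢p.principal
  obtain ⟨f, hf⟩ := hKp.principal
  change stalkIdeal 𝓢 (j x) = Ideal.span {h} at hh
  change stalkIdeal K (j x) = Ideal.span {f} at hf
  have hsum : stalkIdeal (𝓢 ⊔ K) (j x) = Ideal.span {h} ⊔ Ideal.span {f} := by rw [stalkIdeal_sup, hh, hf]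
  have h𝓢le : stalkIdeal 𝓢 (j x) ≤ Ideal.span (Set.range c) := hcI ▸ stalkIdeal_mono (le_sup_left.trans hle) (j x)
  have hKle : stalkIdeal K (j x) ≤ Ideal.span (Set.range c) := hcI ▸ stalkIdeal_mono (le_sup_right.trans hle) (j x)
  have hhc : h ∈ Ideal.span (Set.range c) := h𝓢le (hh ▸ Ideal.mem_span_singleton_self h)
  have hfc : f ∈ Ideal.span (Set.range c) := hKle (hf ▸ Ideal.mem_span_singleton_self f)
  have hhm : h ∈ maximalIdeal _ := hI𝔪 hhc
  have hfm : f ∈ maximalIdeal _ := hI𝔪 hfc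
  -- (3) codimension two forces order one
  haveI : IsRegularLocalRing (X'.presheaf.stalk (j x) ⧸ (Ideal.span {h} ⊔ Ideal.span {f})) := by rw [← hsum]; exact hDreg
  have hdim' : ringKrullDim (X'.presheaf.stalk (j x) ⧸ (Ideal.span {h} ⊔ Ideal.span {f})) + 2 =
      ringKrullDim (X'.presheaf.stalk (j x)) := by rw [← hsum]; exact hDdim
  obtain ⟨hh2, -⟩ := notMem_sq_of_isRegularLocalRing_quotient_codim_two hhm hfm hdim'
  obtain ⟨hf2, -⟩ := notMem_sq_of_isRegularLocalRing_quotient_codim_two' hhm hfm hdim'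
  -- (4) the order-one cone packs
  have hg : Ideal.span (Set.range fun i => (j.stalkMap x).hom (c i)) ≠ ⊤ := by
    rw [span_stalkMap_eq_maximalIdeal_of_model θ hθ r' j t hsq x ϖ hϖO c h𝔪]
    exact (maximalIdeal.isMaximal _).ne_top
  obtain ⟨Φh, hΦh1, hΦhev, hΦhc, hΦhbar⟩ := exists_linearForm_conePack c hc𝔪 hhc hh2 (j.stalkMap x).hom hg
  obtain ⟨Φf, hΦf1, hΦfev, hΦfc, hΦfbar⟩ := exists_linearForm_conePack c hc𝔪 hfc hf2 (j.stalkMap x).hom hg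
  have hcbar : IsQuasiRegular (fun i => (j.stalkMap x).hom (c i)) :=
    isQuasiRegular_stalkMap_model O k θ hθ r' j t hsq x c hc ϖ hϖ hϖc
  -- (5) F⁺5 twice
  have e𝓢 := comap_strictTransformIdeal_eq_of_model τ s.ker 𝓢 hτ j υ j₂ hcomm x hx hυ hJ c hcI hc Φh hΦh1 hΦhc
    (by rw [hΦhev]; exact hh) hcbar hΦhbar
  have eK := comap_strictTransformIdeal_eq_of_model τ s.ker K hτ j υ j₂ hcomm x hx hυ hJ c hcI hc Φf hΦf1 hΦfc
    (by rw [hΦfev]; exact hf) hcbar hΦfbar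
  rw [Scheme.IdealSheafData.comap_sup, e𝓢, eK]

end Summit.ResolutionOfSingularities.ResolutionOfSingularities.Cruxes.EquisingularLiftNat.Sections

end
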